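import Mathlib
import Summits.CriticalPhenomena.PercolationContinuityZ3.Theorems.PercNearOneGluingAdditiveGluingGoodStepLeaf
import HarnessLib

/-! # Crux `PercNearOneGluing.AdditiveGluing` (stmt-CriticalPhenomena-4576), line `subuniform-dead-pocket-maximum`,
# stub `stub_goodStep` — toolkit II: the designated form of goodness and the singleton low fibre

Second of three helper files (siege seat k13 on `stub_goodStep`).  Lands with
`--supports stmt-CriticalPhenomena-4576`.  Notation as in `…GoodStepLeaf`; `τ°(x) = μ(x ↔ b in {o}ᶜ)`.

## Content

* `goodStepK13_one_sub_le_sum` / `goodStepK13_sum_le_one_sub`: the events `{C(x) = W}` over the dead pockets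
  `W ∋ x`, `W ∩ A = ∅` cover, resp. are disjoint pieces of, `{x ↮ A}`:
  `Σ_W μ(C(x) = W) = 1 − μ(x ↔ A)` (the two inequalities).
* `goodStepK13_designated_of_good`: goodness of `(p, A, x, b)` in the line's selection form, taken at the level
  `t = 1 − μ(a₀ ↔ b)` for a relay `a₀` with `μ(a₀ ↔ b) ≤ μ(a ↔ b)` on `A`, is the DESIGNATED inequality
  `μ(a₀ ↔ b) ≤ μ(x ↔ b) + Σ_W μ(C(x) = W) · μ(sel W ↔ b in Wᶜ)` for every selection.
* `goodStepK13_fibre_singleton` — **the fibre `B = {y}` of a low neighbour is the induction hypothesis**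
  (Kozma–Nitzan arXiv:2401.12397, proof of Thm 5 pp. 13–14: under `σ_{x}` the configuration is percolation on
  `G − o` observed from `x`): if `(w⁰, A, y, b)` is good, `y ≠ o`, and `a₀ ∈ A` minimises `τ°` over `A`, then
  `μ(σ_{y} ∩ {a₀ ↔ b}) ≤ μ(σ_{y} ∩ {o ↔ b}) + Σ_{W ∋ o, W ∩ A = ∅} μ(σ_{y} ∩ {C(o) = W}) · μ(sel W ↔ b in Wᶜ)`
  for every selection `sel` — by `μ(σ_{y} ∩ E_G) = μ(σ_{y}) · μ_{w⁰}(E)` termwise (toolkit I) and the designated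
  form of the goodness of `(w⁰, A, y, b)` with the shifted selection `W' ↦ sel (W' ∪ {o})`.

No new definitions. -/

namespace Summit.CriticalPhenomena.PercolationContinuityZ3.Theorems

open MeasureTheory Set
open Literature.Probability.LatticeModels (prodBernoulli)
open Literature.Probability.Percolation (BondConfig openConn openConnIn openGraph openCluster
  openGraph_adj DeterminedBy determinedBy_iff PathIn)

noncomputable section
open Classical

variable {n : ℕ}

/-! ### From goodness to the designated form, under one measure -/

/-- **Cover by dead pockets**: `1 − μ(x ↔ A) ≤ Σ_{W ∋ x, W ∩ A = ∅} μ(C(x) = W)`. [folklore] -/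
theorem goodStepK13_one_sub_le_sum (p : Sym2 (Fin n) → unitInterval) (A : Finset (Fin n)) (x : Fin n) :
    1 - (prodBernoulli p).real (⋃ a ∈ A, (openConn x a : Set (BondConfig (Fin n)))) ≤
      ∑ W ∈ (Finset.univ : Finset (Finset (Fin n))).filter (fun W => x ∈ W ∧ Disjoint W A),
        (prodBernoulli p).real {ω : BondConfig (Fin n) | openCluster ω x = (W : Set (Fin n))} := by
  have hsub : (⋃ a ∈ A, (openConn x a : Set (BondConfig (Fin n))))ᶜ ⊆
      ⋃ W ∈ (Finset.univ : Finset (Finset (Fin n))).filter (fun W => x ∈ W ∧ Disjoint W A),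
        {ω : BondConfig (Fin n) | openCluster ω x = (W : Set (Fin n))} := by
    intro ω hω
    rw [Set.mem_compl_iff, Set.mem_iUnion₂] at hω
    push Not at hω
    refine Set.mem_iUnion₂.2 ⟨Finset.univ.filter fun v : Fin n => v ∈ openCluster ω x,
      Finset.mem_filter.2 ⟨Finset.mem_univ _, ?_, ?_⟩, ?_⟩
    · exact Finset.mem_filter.2 ⟨Finset.mem_univ _, Literature.Probability.Percolation.mem_openCluster_self ω x⟩
    · rw [Finset.disjoint_left]
      intro a ha haA
      have hra : (openGraph ω).Reachable x a := (Finset.mem_filter.1 ha).2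
      exact hω a haA hra
    · show openCluster ω x = ↑(Finset.univ.filter fun v : Fin n => v ∈ openCluster ω x)
      rw [Finset.coe_filter]
      ext v
      simp
  have h := measureReal_mono (μ := prodBernoulli p) hsub (measure_ne_top _ _)
  rw [probReal_compl_eq_one_sub (Set.toFinite _).measurableSet] at h
  exact h.trans (measureReal_biUnion_finset_le _ _)

/-- The events `{C(x) = W}` over the dead pockets `W` are disjoint pieces of `{x ↮ A}`:
`Σ_{W ∋ x, W ∩ A = ∅} μ(C(x) = W) ≤ 1 − μ(x ↔ A)`. [folklore] -/
theorem goodStepK13_sum_le_one_sub (p : Sym2 (Fin n) → unitInterval) (A : Finset (Fin n)) (x : Fin n) :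
    ∑ W ∈ (Finset.univ : Finset (Finset (Fin n))).filter (fun W => x ∈ W ∧ Disjoint W A),
        (prodBernoulli p).real {ω : BondConfig (Fin n) | openCluster ω x = (W : Set (Fin n))} ≤
      1 - (prodBernoulli p).real (⋃ a ∈ A, (openConn x a : Set (BondConfig (Fin n)))) := by
  rw [← measureReal_biUnion_finset (μ := prodBernoulli p)
      (fun W _ W' _ hWW' => Set.disjoint_left.2 fun ω hω hω' => hWW' ?_)
      (fun W _ => (Set.toFinite _).measurableSet)]
  · have hsub : (⋃ W ∈ (Finset.univ : Finset (Finset (Fin n))).filter (fun W => x ∈ W ∧ Disjoint W A),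
          {ω : BondConfig (Fin n) | openCluster ω x = (W : Set (Fin n))}) ⊆
        (⋃ a ∈ A, (openConn x a : Set (BondConfig (Fin n))))ᶜ := by
      intro ω hω
      obtain ⟨W, hW, hωW⟩ := Set.mem_iUnion₂.1 hω
      have hW' := (Finset.mem_filter.1 hW).2
      rw [Set.mem_compl_iff, Set.mem_iUnion₂]
      rintro ⟨a, haA, hωa⟩
      have haC : a ∈ openCluster ω x := hωa
      rw [show openCluster ω x = (W : Set (Fin n)) from hωW] at haC
      exact Finset.disjoint_left.1 hW'.2 (Finset.mem_coe.1 haC) haA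
    have h := measureReal_mono (μ := prodBernoulli p) hsub (measure_ne_top _ _)
    rwa [probReal_compl_eq_one_sub (Set.toFinite _).measurableSet] at h
  · have h1 : openCluster ω x = (W : Set (Fin n)) := hω
    have h2 : openCluster ω x = (W' : Set (Fin n)) := hω'
    exact Finset.coe_injective (h1.symm.trans h2)

/-- **Goodness implies the designated inequality for any relay dominated off-hand**: if `(p, A, x, b)` is
good (selection form, displayed hypothesis `hgood`) and `a₀ ∈ A` satisfies `μ(a₀ ↔ b) ≤ μ(a ↔ b)` on `A`,
then `μ(a₀ ↔ b) ≤ μ(x ↔ b) + Σ_{W ∋ x, W ∩ A = ∅} μ(C(x) = W) · μ(sel W ↔ b in Wᶜ)` for every selection.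
(Kozma–Nitzan arXiv:2401.12397 §3.2: goodness at the level `t = 1 − min_A τ`.) -/
theorem goodStepK13_designated_of_good (p : Sym2 (Fin n) → unitInterval) (A : Finset (Fin n)) (x b a₀ : Fin n)
    (hb : b ∈ A)
    (hmin : ∀ a ∈ A, (prodBernoulli p).real (openConn a₀ b) ≤ (prodBernoulli p).real (openConn a b))
    (hgood : ∀ (t : ℝ) (sel : Finset (Fin n) → Fin n), (∀ W, sel W ∈ A) →
      (∀ a ∈ A, 1 - t ≤ (prodBernoulli p).real (openConn a b)) →
      (prodBernoulli p).real ((⋃ a ∈ A, openConn x a) ∩ (openConn x b)ᶜ)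
        + ∑ W ∈ (Finset.univ : Finset (Finset (Fin n))).filter (fun W => x ∈ W ∧ Disjoint W A),
            (prodBernoulli p).real {ω : BondConfig (Fin n) | openCluster ω x = (W : Set (Fin n))}
              * (prodBernoulli p).real (openConnIn ((W : Set (Fin n))ᶜ) (sel W) b)ᶜ
        ≤ t)
    (sel : Finset (Fin n) → Fin n) (hsel : ∀ W, sel W ∈ A) :
    (prodBernoulli p).real (openConn a₀ b) ≤ (prodBernoulli p).real (openConn x b) +
      ∑ W ∈ (Finset.univ : Finset (Finset (Fin n))).filter (fun W => x ∈ W ∧ Disjoint W A),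
        (prodBernoulli p).real {ω : BondConfig (Fin n) | openCluster ω x = (W : Set (Fin n))}
          * (prodBernoulli p).real (openConnIn ((W : Set (Fin n))ᶜ) (sel W) b) := by
  have h := hgood (1 - (prodBernoulli p).real (openConn a₀ b)) sel hsel fun a ha => by linarith [hmin a ha]
  have hsub : (openConn x b : Set (BondConfig (Fin n))) ⊆ ⋃ a ∈ A, openConn x a := fun ω hω =>
    Set.mem_iUnion₂.2 ⟨b, hb, hω⟩
  have hlive : (prodBernoulli p).real ((⋃ a ∈ A, openConn x a) ∩ (openConn x b)ᶜ) =
      (prodBernoulli p).real (⋃ a ∈ A, (openConn x a : Set (BondConfig (Fin n)))) -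
        (prodBernoulli p).real (openConn x b) := by
    rw [← Set.sdiff_eq, measureReal_sdiff hsub (Set.toFinite _).measurableSet (measure_ne_top _ _)]
  have hcov := goodStepK13_one_sub_le_sum p A x
  have hcompl : ∀ W : Finset (Fin n), (prodBernoulli p).real (openConnIn ((W : Set (Fin n))ᶜ) (sel W) b)ᶜ =
      1 - (prodBernoulli p).real (openConnIn ((W : Set (Fin n))ᶜ) (sel W) b) := fun W =>
    probReal_compl_eq_one_sub (Set.toFinite _).measurableSet
  simp only [hcompl, mul_sub, mul_one, Finset.sum_sub_distrib] at h
  rw [hlive] at h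
  linarith

/-! ### The singleton low fibre is the induction hypothesis -/

/-- **The fibre `B = {y}` of a low neighbour.**  If `(w⁰, A, y, b)` is good (displayed hypothesis `hgood`,
an instance of the induction hypothesis of `stub_goodStep`), `y ∉ A`, `y ≠ o`, and `a₀ ∈ A` minimises
`τ°` over `A`, then
`μ(σ_{y} ∩ {a₀ ↔ b}) ≤ μ(σ_{y} ∩ {o ↔ b}) + Σ_{W ∋ o, W ∩ A = ∅} μ(σ_{y} ∩ {C(o) = W}) · μ(sel W ↔ b in Wᶜ)`.
(Kozma–Nitzan arXiv:2401.12397, proof of Thm 5, pp. 13–14: under `σ_{x}` the configuration is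
percolation on `G − o` observed from `x`.) -/
theorem goodStepK13_fibre_singleton (w w0 : Sym2 (Fin n) → unitInterval) (A : Finset (Fin n)) (o b a₀ y : Fin n)
    (hw0 : ∀ e, o ∈ e → w0 e = 0) (hw0' : ∀ e, o ∉ e → w0 e = w e)
    (hbA : b ∈ A) (hoA : o ∉ A) (ha₀A : a₀ ∈ A) (hyo : y ≠ o)
    (hmin : ∀ v ∈ A, (prodBernoulli w).real (openConnIn (({o} : Set (Fin n))ᶜ) a₀ b)
      ≤ (prodBernoulli w).real (openConnIn (({o} : Set (Fin n))ᶜ) v b))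
    (hgood : ∀ (t : ℝ) (sel : Finset (Fin n) → Fin n), (∀ W, sel W ∈ A) →
      (∀ a ∈ A, 1 - t ≤ (prodBernoulli w0).real (openConn a b)) →
      (prodBernoulli w0).real ((⋃ a ∈ A, openConn y a) ∩ (openConn y b)ᶜ)
        + ∑ W ∈ (Finset.univ : Finset (Finset (Fin n))).filter (fun W => y ∈ W ∧ Disjoint W A),
            (prodBernoulli w0).real {ω : BondConfig (Fin n) | openCluster ω y = (W : Set (Fin n))}
              * (prodBernoulli w0).real (openConnIn ((W : Set (Fin n))ᶜ) (sel W) b)ᶜ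
        ≤ t)
    (sel : Finset (Fin n) → Fin n) (hsel : ∀ W, sel W ∈ A) :
    (prodBernoulli w).real
        ({ω : BondConfig (Fin n) | ∀ z : Fin n, z ≠ o → (s(o, z) ∈ ω ↔ z ∈ ({y} : Finset (Fin n)))} ∩
          openConn a₀ b) ≤
      (prodBernoulli w).real
          ({ω : BondConfig (Fin n) | ∀ z : Fin n, z ≠ o → (s(o, z) ∈ ω ↔ z ∈ ({y} : Finset (Fin n)))} ∩
            openConn o b) +
        ∑ W ∈ (Finset.univ : Finset (Finset (Fin n))).filter (fun W => o ∈ W ∧ Disjoint W A),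
          (prodBernoulli w).real
              ({ω : BondConfig (Fin n) | ∀ z : Fin n, z ≠ o → (s(o, z) ∈ ω ↔ z ∈ ({y} : Finset (Fin n)))} ∩
                {ω : BondConfig (Fin n) | openCluster ω o = (W : Set (Fin n))})
            * (prodBernoulli w).real (openConnIn ((W : Set (Fin n))ᶜ) (sel W) b) := by
  have hbo : b ≠ o := fun h => hoA (h ▸ hbA)
  have ha₀o : a₀ ≠ o := fun h => hoA (h ▸ ha₀A)
  -- abbreviations
  set σ : Set (BondConfig (Fin n)) :=
    {ω : BondConfig (Fin n) | ∀ z : Fin n, z ≠ o → (s(o, z) ∈ ω ↔ z ∈ ({y} : Finset (Fin n)))} with hσdef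
  set c : ℝ := (prodBernoulli w).real σ with hcdef
  have hc : 0 ≤ c := measureReal_nonneg
  -- (1) probabilities under w0 are w-probabilities of ρ-preimages
  have hkill : ∀ E : Set (BondConfig (Fin n)), (prodBernoulli w0).real E =
      (prodBernoulli w).real ((fun ω : BondConfig (Fin n) => {e ∈ ω | o ∉ e}) ⁻¹' E) :=
    goodStepK13_real_kill w w0 o hw0 hw0'
  -- (2) relay comparison under w0: a₀ is the minimiser
  have hconn : ∀ a : Fin n, a ≠ o → (prodBernoulli w0).real (openConn a b) =
      (prodBernoulli w).real (openConnIn (({o} : Set (Fin n))ᶜ) a b) := fun a ha => by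
    rw [hkill, goodStepK13_preimage_del_openConn o a b ha]
  have hmin0 : ∀ a ∈ A, (prodBernoulli w0).real (openConn a₀ b) ≤ (prodBernoulli w0).real (openConn a b) := by
    intro a ha
    rw [hconn a₀ ha₀o, hconn a (fun h => hoA (h ▸ ha))]
    exact hmin a ha
  -- (3) the designated inequality under w0, with the shifted selection
  set sel0 : Finset (Fin n) → Fin n := fun W' => sel (insert o W') with hsel0def
  have hsel0 : ∀ W', sel0 W' ∈ A := fun W' => hsel _
  have hdes := goodStepK13_designated_of_good w0 A y b a₀ hbA hmin0 hgood sel0 hsel0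
  -- (4) translate every term
  set T' := (Finset.univ : Finset (Finset (Fin n))).filter (fun W => y ∈ W ∧ Disjoint W A) with hT'def
  set T := (Finset.univ : Finset (Finset (Fin n))).filter (fun W => o ∈ W ∧ Disjoint W A) with hTdef
  have h1 : c * (prodBernoulli w0).real (openConn a₀ b) = (prodBernoulli w).real (σ ∩ openConn a₀ b) := by
    rw [hkill, hcdef, ← goodStepK13_real_fibre_preimage w o {y} (openConn a₀ b), hσdef,
      goodStepK13_leaf_inter_openConn o y a₀ b hyo ha₀o hbo]
  have h2 : c * (prodBernoulli w0).real (openConn y b) = (prodBernoulli w).real (σ ∩ openConn o b) := by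
    rw [hkill, hcdef, ← goodStepK13_real_fibre_preimage w o {y} (openConn y b), hσdef,
      goodStepK13_leaf_inter_openConn_obs o y b hyo hbo]
  -- the pocket terms
  have hterm : ∀ W' ∈ T', c * ((prodBernoulli w0).real {ω : BondConfig (Fin n) | openCluster ω y = (W' : Set (Fin n))}
        * (prodBernoulli w0).real (openConnIn ((W' : Set (Fin n))ᶜ) (sel0 W') b)) ≤
      if o ∈ W' then 0 else
        (prodBernoulli w).real (σ ∩ {ω : BondConfig (Fin n) | openCluster ω o = ((insert o W' : Finset (Fin n)) : Set (Fin n))})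
          * (prodBernoulli w).real (openConnIn (((insert o W' : Finset (Fin n)) : Set (Fin n))ᶜ) (sel (insert o W')) b) := by
    intro W' _
    by_cases hoW : o ∈ W'
    · rw [if_pos hoW, hkill {ω : BondConfig (Fin n) | openCluster ω y = (W' : Set (Fin n))},
        goodStepK13_preimage_cluster_empty o y hyo W' hoW]
      simp
    · rw [if_neg hoW, ← mul_assoc, hkill {ω : BondConfig (Fin n) | openCluster ω y = (W' : Set (Fin n))}, hcdef,
        ← goodStepK13_real_fibre_preimage w o {y}, hσdef, goodStepK13_leaf_inter_cluster o y hyo W' hoW]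
      refine mul_le_mul_of_nonneg_left ?_ measureReal_nonneg
      rw [hkill]
      refine (measureReal_mono (μ := prodBernoulli w)
        (goodStepK13_preimage_del_openConnIn_subset o _ _ b fun h => hoA (h ▸ hsel _))).trans (le_of_eq ?_)
      rw [Finset.coe_insert, ← Set.union_singleton, Set.compl_union, Set.sdiff_eq]
  -- sum of the translated pocket terms is at most the full sum over T
  have hsum : c * ∑ W' ∈ T', (prodBernoulli w0).real {ω : BondConfig (Fin n) | openCluster ω y = (W' : Set (Fin n))}
        * (prodBernoulli w0).real (openConnIn ((W' : Set (Fin n))ᶜ) (sel0 W') b) ≤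
      ∑ W ∈ T, (prodBernoulli w).real (σ ∩ {ω : BondConfig (Fin n) | openCluster ω o = (W : Set (Fin n))})
        * (prodBernoulli w).real (openConnIn ((W : Set (Fin n))ᶜ) (sel W) b) := by
    rw [Finset.mul_sum]
    refine (Finset.sum_le_sum hterm).trans ?_
    rw [← Finset.sum_filter_add_sum_filter_not T' (fun W' => o ∈ W')]
    have hzero : ∑ W' ∈ T'.filter (fun W' => o ∈ W'),
        (if o ∈ W' then (0 : ℝ) else
          (prodBernoulli w).real (σ ∩ {ω : BondConfig (Fin n) | openCluster ω o = ((insert o W' : Finset (Fin n)) : Set (Fin n))})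
            * (prodBernoulli w).real (openConnIn (((insert o W' : Finset (Fin n)) : Set (Fin n))ᶜ) (sel (insert o W')) b)) = 0 :=
      Finset.sum_eq_zero fun W' hW' => by rw [if_pos (Finset.mem_filter.1 hW').2]
    rw [hzero, zero_add]
    have hrew : ∑ W' ∈ T'.filter (fun W' => ¬ o ∈ W'),
        (if o ∈ W' then (0 : ℝ) else
          (prodBernoulli w).real (σ ∩ {ω : BondConfig (Fin n) | openCluster ω o = ((insert o W' : Finset (Fin n)) : Set (Fin n))})
            * (prodBernoulli w).real (openConnIn (((insert o W' : Finset (Fin n)) : Set (Fin n))ᶜ) (sel (insert o W')) b)) =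
        ∑ W ∈ (T'.filter (fun W' => ¬ o ∈ W')).image (insert o),
          (prodBernoulli w).real (σ ∩ {ω : BondConfig (Fin n) | openCluster ω o = (W : Set (Fin n))})
            * (prodBernoulli w).real (openConnIn ((W : Set (Fin n))ᶜ) (sel W) b) := by
      rw [Finset.sum_image]
      · refine Finset.sum_congr rfl fun W' hW' => ?_
        rw [if_neg (Finset.mem_filter.1 hW').2]
      · intro W₁ hW₁ W₂ hW₂ h
        have h₁ := (Finset.mem_filter.1 hW₁).2
        have h₂ := (Finset.mem_filter.1 hW₂).2
        rw [← Finset.erase_insert h₁, h, Finset.erase_insert h₂]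
    rw [hrew]
    refine Finset.sum_le_sum_of_subset_of_nonneg (fun W hW => ?_) fun W _ _ =>
      mul_nonneg measureReal_nonneg measureReal_nonneg
    obtain ⟨W', hW', rfl⟩ := Finset.mem_image.1 hW
    have hW'T := (Finset.mem_filter.1 (Finset.mem_filter.1 hW').1).2
    refine Finset.mem_filter.2 ⟨Finset.mem_univ _, Finset.mem_insert_self o W', ?_⟩
    rw [Finset.disjoint_insert_left]
    exact ⟨hoA, hW'T.2⟩
  -- (5) assemble: multiply the designated inequality by c
  have hmul := mul_le_mul_of_nonneg_left hdes hc
  rw [mul_add, h1, h2] at hmul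
  exact hmul.trans (by linarith [hsum])

/-- Registered form (`stub_goodStepFibreSingleton_k13` on stmt-CriticalPhenomena-4576) of
`goodStepK13_fibre_singleton`: the singleton low fibre of the inductive step is the goodness of `(w⁰, A, y, b)`.
(Kozma–Nitzan arXiv:2401.12397, proof of Thm 5, pp. 13–14.) -/
theorem stub_goodStepFibreSingleton_k13 :
    ∀ (n : ℕ) (w w0 : Sym2 (Fin n) → unitInterval) (A : Finset (Fin n)) (o b a₀ y : Fin n), (∀ e, o ∈ e →
      w0 e = 0) → (∀ e, o ∉ e → w0 e = w e) → b ∈ A → o ∉ A → a₀ ∈ A → y ≠ o → (∀ v ∈ A, (prodBernoulli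
      w).real (openConnIn (({o} : Set (Fin n))ᶜ) a₀ b) ≤ (prodBernoulli w).real (openConnIn (({o} : Set
      (Fin n))ᶜ) v b)) → (∀ (t : ℝ) (sel : Finset (Fin n) → Fin n), (∀ W, sel W ∈ A) → (∀ a ∈ A, 1 - t ≤
      (prodBernoulli w0).real (openConn a b)) → (prodBernoulli w0).real ((⋃ a ∈ A, openConn y a) ∩
      (openConn y b)ᶜ) + ∑ W ∈ (Finset.univ : Finset (Finset (Fin n))).filter (fun W => y ∈ W ∧ Disjoint W
      A), (prodBernoulli w0).real {ω : BondConfig (Fin n) | openCluster ω y = (W : Set (Fin n))} *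
      (prodBernoulli w0).real (openConnIn ((W : Set (Fin n))ᶜ) (sel W) b)ᶜ ≤ t) → ∀ (sel : Finset (Fin n) →
      Fin n), (∀ W, sel W ∈ A) → (prodBernoulli w).real ({ω : BondConfig (Fin n) | ∀ z : Fin n, z ≠ o →
      (s(o, z) ∈ ω ↔ z ∈ ({y} : Finset (Fin n)))} ∩ openConn a₀ b) ≤ (prodBernoulli w).real ({ω :
      BondConfig (Fin n) | ∀ z : Fin n, z ≠ o → (s(o, z) ∈ ω ↔ z ∈ ({y} : Finset (Fin n)))} ∩ openConn o b)
      + ∑ W ∈ (Finset.univ : Finset (Finset (Fin n))).filter (fun W => o ∈ W ∧ Disjoint W A),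
      (prodBernoulli w).real ({ω : BondConfig (Fin n) | ∀ z : Fin n, z ≠ o → (s(o, z) ∈ ω ↔ z ∈ ({y} :
      Finset (Fin n)))} ∩ {ω : BondConfig (Fin n) | openCluster ω o = (W : Set (Fin n))}) * (prodBernoulli
      w).real (openConnIn ((W : Set (Fin n))ᶜ) (sel W) b) :=
  fun _ w w0 A o b a₀ y hw0 hw0' hbA hoA ha₀A hyo hmin hgood sel hsel =>
    goodStepK13_fibre_singleton w w0 A o b a₀ y hw0 hw0' hbA hoA ha₀A hyo hmin hgood sel hsel

end

end Summit.CriticalPhenomena.PercolationContinuityZ3.Theorems
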